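import Summits.BirchSwinnertonDyer.BirchSwinnertonDyer.Theorems.ManinLocalTwoThreeShimuraIndexAtTwo
import Summits.BirchSwinnertonDyer.BirchSwinnertonDyer.Theorems.ManinLocalTwoThreeShimuraFiveTransport
import Summits.BirchSwinnertonDyer.BirchSwinnertonDyer.Theorems.ManinLocalTwoThreeAtkinLehnerShimuraSignLaw
import HarnessLib

/-!
# The BAD-PRIME SIEVE for the Shimura index: `ℓ ∣ [Λ₀(f) : Λ₁(f)]` forces `p ≡ a_p(f) (mod ℓ)` at every `p ∥ N` and `p = ℓ` at
# every `p² ∣ N`; the LEVEL PROFILE of a `5` in the index: `N = 5^e · 11 · ∏ pᵢ`, `e ≠ 1`, `11 ∥ N` split, `pᵢ ≡ −1 (mod 5)` non-split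

Summit `BirchSwinnertonDyer`, route `ManinLocalTwoThree` (cell bsd-f2-manin, seat es g43, ROAD γ; MEMO-es §66), crux C2 `ManinOddAtFour`
(stmt-BirchSwinnertonDyer-22967, helper; bears on the cell row E-es-224 `EsG43.ShimuraFiveOnlyAtEleven`).
`Λ₀(f) = periodLattice f`, `Λ₁(f) = periodLatticeGamma1 f`, `ShimuraIndexPrimeTo ℓ f` = «`Λ₀(f)/Λ₁(f)` has no element of order `ℓ`».

MECHANISM.  Ling–Oesterlé's «`U_p = p` on `Σ(N)` for `p ∣ N`» in the tree's period-lattice form (THEOREM W,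
`heckeEigenPeriodCongruence_holds`: `(a_p(f) − p)·Λ₀(f) ⊆ Λ₁(f)`) and Atkin–Lehner's Theorem 3 (`a_p(f) = ±1` at `p ∥ N`,
`a_p(f) = 0` at `p² ∣ N`; tree `IsNewform0.cuspCoeff_sq_eq_one_of_dvd_of_not_sq_dvd` / `…cuspCoeff_eq_zero_of_sq_dvd`) give an
INTEGER `a_p(f) − p` killing `Λ₀/Λ₁`; an element of prime order `ℓ` survives only if `ℓ ∣ a_p(f) − p` (Bézout, tree
`mem_of_intCast_mul_mem_of_prime_mul_mem`).  The tree had this at `p = 2` only (`…ShimuraIndexAtTwo`, es g42).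

* §1 (every level, every newform `f ∈ S₂(Γ₀(N))`, every prime `ℓ`): `exists_intCast_eq_cuspCoeff_of_dvd`, `sub_mul_mem_periodLatticeGamma1_of_dvd`
  (THEOREM W at `p`), **`dvd_sub_of_not_shimuraIndexPrimeTo`** (`ℓ ∣ a_p − p`), **`eq_of_sq_dvd_of_not_shimuraIndexPrimeTo`** (`p² ∣ N ⟹ p = ℓ`:
  away from `ℓ` the level is SQUAREFREE), **`cuspCoeff_eq_of_not_sq_dvd_of_not_shimuraIndexPrimeTo`** (`p ∥ N ⟹ a_p = 1 ∧ ℓ ∣ p − 1` or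
  `a_p = −1 ∧ ℓ ∣ p + 1`), `sq_dvd_of_dvd_of_not_shimuraIndexPrimeTo` (`ℓ ∣ N ⟹ ℓ² ∣ N`).
* §2 (`ℓ` odd, with THEOREM AL = tree `atkinLehnerShimuraSignLaw_holds`): **`cuspCoeff_eq_neg_one_of_ne_of_not_shimuraIndexPrimeTo`** — if the
  unique prime of Atkin–Lehner sign `−1` is `q ∥ N`, then every OTHER `p ∥ N` has `a_p = −1` and `ℓ ∣ p + 1`.
* §3 (`ℓ = 5`, numerics): `level_profile_five` (`p ∣ N ⟹ p = 5 ∧ 25 ∣ N`, or `p ∥ N ∧ a_p = 1 ∧ p ≡ 1 (5)`, or `p ∥ N ∧ a_p = −1 ∧ p ≡ 4 (5)`),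
  `not_dvd_level_of_mod_five` (no prime `≡ ±2 (mod 5)` divides `N`: `2, 3, 7, 13, 17, 23, …`), `twentyfive_dvd_of_five_dvd`, `level_coprime_fortytwo`
  (row E-es-230).
* §4 (`ℓ = 5` on a lattice-optimal `X₀(N)`-datum of a minimal `W₀`, with ROAD β = tree `ShimuraFive.eleven_dvd_level_of_not_shimuraIndexPrimeTo_five`):
  **`eleven_profile`** (`11 ∥ N`, `a₁₁(f) = +1`, Atkin–Lehner sign `−1` at `11`), **`level_profile_five_datum`** — THE LEVEL PROFILE: every prime
  `p ∣ N` is `5` (with `25 ∣ N`), or `11` (simple, split), or a simple NON-SPLIT prime `p ≡ −1 (mod 5)`; hopt-free at squarefree `N`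
  (`level_profile_five_of_squarefree`: then also `5 ∤ N`).  CONSEQUENCE for the cell row E-es-224 (`5 ∣ [Λ₀:Λ₁] ⟹ N = 11`): its open residual is
  `{25 ∣ N}` ∪ `{N = 11·∏pᵢ squarefree, pᵢ ≡ −1 (5) non-split}` — the second set is Byeon–Kim's printed range (`N` squarefree, `5 ∤ N` is AUTOMATIC).

CENSUS (cell pack `HOME/es/g43/E226-sieve-check-g43.txt`, E15 table 0f2795b49f3ad4a5, 1025 optimal classes, `N ≤ 19870`): 99 pairs (class, `ℓ ∣` index),
`ℓ = 2`: 75, `ℓ = 3`: 23, `ℓ = 5`: 1 — LAW S (§1) 0 violations; sign count (§2) 0 violations; e.g. `ℓ = 3`: `14a (2⁻7⁺) 19a 26a (2⁻13⁺) 27a 35a (5⁻7⁺)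
37b 38a 54a 77b (7⁺11⁻) … 19870a (2⁻5⁻1987⁺)` — one split prime `≡ 1 (3)`, all others non-split `≡ 2 (3)`, additive only at `3`.

HONEST FRAMING: unconditional theorems (standard axioms); no definitions, no named facts, no sorry.  E-es-224, C2, C3, Manin's conjecture and
BSD are NOT proved by this file. [cite: LingOesterle1991, Thm. 6 (p. 176)] [cite: AtkinLehner1970, Thm. 3] [cite: ByeonKim2014, Thm. 1.1 and Prop. 4.1]
[cite: Vatsal2005, Thm. 1.1 and Rem. 1.8]
-/

set_option autoImplicit false
set_option linter.dupNamespace false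

noncomputable section

open scoped Classical MatrixGroups ModularForm

open CongruenceSubgroup Complex WeierstrassCurve Literature.NumberTheory.EllipticCurves
  Literature.NumberTheory.EllipticCurves.ModularForms
open Summit.BirchSwinnertonDyer.Rank1Residual.ManinAdditive Summit.BirchSwinnertonDyer.Rank1Residual.ManinAdditive.KatoCurve
open Summit.BirchSwinnertonDyer.BirchSwinnertonDyer.Theorems.ManinLocalTwoThree

namespace Summit.BirchSwinnertonDyer.BirchSwinnertonDyer.Theorems.ManinLocalTwoThree.ShimuraSieve

/-! ## §1 The sieve at a general prime `ℓ` (level and newform only) -/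

section General

variable {N : ℕ} [NeZero N]

/-- Atkin–Lehner, Theorem 3, in integer form: at a prime `p ∣ N` the coefficient `a_p(f)` of a newform is an INTEGER `e` with `e = 0` if
`p² ∣ N` and `e = ±1` if `p ∥ N`. [cite: AtkinLehner1970, Thm. 3] -/
theorem exists_intCast_eq_cuspCoeff_of_dvd {f : CuspForm (Gamma0 N) 2} (hf : IsNewform0 f) {p : ℕ} (hp : p.Prime) (hpN : p ∣ N) :
    ∃ e : ℤ, cuspCoeff f p = (e : ℂ) ∧ ((p ^ 2 ∣ N ∧ e = 0) ∨ (¬ p ^ 2 ∣ N ∧ (e = 1 ∨ e = -1))) := by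
  by_cases h2 : p ^ 2 ∣ N
  · exact ⟨0, by rw [hf.cuspCoeff_eq_zero_of_sq_dvd hp h2]; simp, Or.inl ⟨h2, rfl⟩⟩
  · have hsq : cuspCoeff f p ^ 2 = 1 := hf.cuspCoeff_sq_eq_one_of_dvd_of_not_sq_dvd hp hpN h2
    rw [sq, mul_self_eq_one_iff] at hsq
    rcases hsq with h | h
    · exact ⟨1, by rw [h]; simp, Or.inr ⟨h2, Or.inl rfl⟩⟩
    · exact ⟨-1, by rw [h]; simp, Or.inr ⟨h2, Or.inr rfl⟩⟩

/-- **THEOREM W at `p`** (Ling–Oesterlé «`U_p = p` on `Σ(N)`», period-lattice form, tree `heckeEigenPeriodCongruence_holds`):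
`(a_p(f) − p)·Λ₀(f) ⊆ Λ₁(f)` for a newform `f` and a prime `p ∣ N`. [cite: LingOesterle1991, Thm. 6 (p. 176)] -/
theorem sub_mul_mem_periodLatticeGamma1_of_dvd {f : CuspForm (Gamma0 N) 2} (hf : IsNewform0 f) {p : ℕ} (hp : p.Prime)
    (hpN : p ∣ N) {z : ℂ} (hz : z ∈ periodLattice f) : (cuspCoeff f p - p) * z ∈ periodLatticeGamma1 f := by
  haveI : NeZero p := ⟨hp.ne_zero⟩
  have h := heckeEigenPeriodCongruence_holds N p f (cuspCoeff f p) hp hpN (hf.heckeT_eq_coeff_smul hp) z hz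
  exact_mod_cast h

/-- **THE BAD-PRIME SIEVE.**  If `Λ₀(f)/Λ₁(f)` has an element of prime order `ℓ` then `ℓ ∣ a_p(f) − p` for every prime `p ∣ N`
(`a_p(f) = e ∈ ℤ`). [cite: LingOesterle1991, Thm. 6] [cite: AtkinLehner1970, Thm. 3] -/
theorem dvd_sub_of_not_shimuraIndexPrimeTo {f : CuspForm (Gamma0 N) 2} (hf : IsNewform0 f) {ℓ : ℕ} (hℓ : ℓ.Prime)
    (hS : ¬ ShimuraIndexPrimeTo ℓ f) {p : ℕ} (hp : p.Prime) (hpN : p ∣ N) {e : ℤ} (he : cuspCoeff f p = (e : ℂ)) :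
    (ℓ : ℤ) ∣ e - p := by
  by_contra hnd
  apply hS
  intro x hx hℓx
  have hE : ((e - p : ℤ) : ℂ) * x ∈ periodLatticeGamma1 f := by
    have h := sub_mul_mem_periodLatticeGamma1_of_dvd hf hp hpN hx
    rw [he] at h
    exact_mod_cast h
  exact mem_of_intCast_mul_mem_of_prime_mul_mem hℓ hnd hE hℓx

/-- **Additive primes are `ℓ`.**  If `ℓ ∣ [Λ₀(f):Λ₁(f)]` and `p² ∣ N` then `p = ℓ` (`a_p = 0`, so `ℓ ∣ p`): away from `ℓ` the level of a
newform with an `ℓ` in its Shimura index is SQUAREFREE. [cite: LingOesterle1991, Thm. 6] [cite: AtkinLehner1970, Thm. 3] -/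
theorem eq_of_sq_dvd_of_not_shimuraIndexPrimeTo {f : CuspForm (Gamma0 N) 2} (hf : IsNewform0 f) {ℓ : ℕ} (hℓ : ℓ.Prime)
    (hS : ¬ ShimuraIndexPrimeTo ℓ f) {p : ℕ} (hp : p.Prime) (hp2 : p ^ 2 ∣ N) : p = ℓ := by
  have h0 : cuspCoeff f p = ((0 : ℤ) : ℂ) := by rw [hf.cuspCoeff_eq_zero_of_sq_dvd hp hp2]; simp
  have hd := dvd_sub_of_not_shimuraIndexPrimeTo hf hℓ hS hp ((dvd_pow_self p two_ne_zero).trans hp2) h0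
  rw [zero_sub, dvd_neg, Int.natCast_dvd_natCast] at hd
  exact ((Nat.prime_dvd_prime_iff_eq hℓ hp).mp hd).symm

/-- No square of a prime `p ≠ ℓ` divides the level. -/
theorem not_sq_dvd_of_ne_of_not_shimuraIndexPrimeTo {f : CuspForm (Gamma0 N) 2} (hf : IsNewform0 f) {ℓ : ℕ} (hℓ : ℓ.Prime)
    (hS : ¬ ShimuraIndexPrimeTo ℓ f) {p : ℕ} (hp : p.Prime) (hne : p ≠ ℓ) : ¬ p ^ 2 ∣ N :=
  fun h ↦ hne (eq_of_sq_dvd_of_not_shimuraIndexPrimeTo hf hℓ hS hp h)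

/-- **Multiplicative primes are `≡ a_p (mod ℓ)`.**  If `ℓ ∣ [Λ₀(f):Λ₁(f)]` and `p ∥ N` then `a_p(f) = 1 ∧ ℓ ∣ p − 1` (split) or
`a_p(f) = −1 ∧ ℓ ∣ p + 1` (non-split). [cite: LingOesterle1991, Thm. 6] [cite: AtkinLehner1970, Thm. 3] -/
theorem cuspCoeff_eq_of_not_sq_dvd_of_not_shimuraIndexPrimeTo {f : CuspForm (Gamma0 N) 2} (hf : IsNewform0 f) {ℓ : ℕ}
    (hℓ : ℓ.Prime) (hS : ¬ ShimuraIndexPrimeTo ℓ f) {p : ℕ} (hp : p.Prime) (hpN : p ∣ N) (hp2 : ¬ p ^ 2 ∣ N) :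
    (cuspCoeff f p = 1 ∧ (ℓ : ℤ) ∣ (p : ℤ) - 1) ∨ (cuspCoeff f p = -1 ∧ (ℓ : ℤ) ∣ (p : ℤ) + 1) := by
  obtain ⟨e, he, hcase⟩ := exists_intCast_eq_cuspCoeff_of_dvd hf hp hpN
  have hd := dvd_sub_of_not_shimuraIndexPrimeTo hf hℓ hS hp hpN he
  rcases hcase with ⟨h2, -⟩ | ⟨-, rfl | rfl⟩
  · exact absurd h2 hp2
  · refine Or.inl ⟨by rw [he]; simp, ?_⟩
    have : (ℓ : ℤ) ∣ -(1 - (p : ℤ)) := dvd_neg.mpr hd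
    simpa using this
  · refine Or.inr ⟨by rw [he]; simp, ?_⟩
    have : (ℓ : ℤ) ∣ -(-1 - (p : ℤ)) := dvd_neg.mpr hd
    have h' : -(-1 - (p : ℤ)) = p + 1 := by ring
    rwa [h'] at this

/-- `ℓ` itself never divides the level exactly once: `ℓ ∣ [Λ₀:Λ₁]`, `ℓ ∣ N ⟹ ℓ² ∣ N` (`a_ℓ = ±1` would give `ℓ ∣ ±1 − ℓ`). -/
theorem sq_dvd_of_dvd_of_not_shimuraIndexPrimeTo {f : CuspForm (Gamma0 N) 2} (hf : IsNewform0 f) {ℓ : ℕ} (hℓ : ℓ.Prime)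
    (hS : ¬ ShimuraIndexPrimeTo ℓ f) (hℓN : ℓ ∣ N) : ℓ ^ 2 ∣ N := by
  by_contra h2
  have h1 : ¬ (ℓ : ℤ) ∣ 1 := by
    intro h
    have h' : (ℓ : ℤ) = 1 := Int.eq_one_of_dvd_one (by positivity) h
    exact hℓ.ne_one (by exact_mod_cast h')
  rcases cuspCoeff_eq_of_not_sq_dvd_of_not_shimuraIndexPrimeTo hf hℓ hS hℓ hℓN h2 with ⟨-, hd⟩ | ⟨-, hd⟩
  · exact h1 ((dvd_sub_right (dvd_refl (ℓ : ℤ))).mp hd)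
  · exact h1 ((dvd_add_right (dvd_refl (ℓ : ℤ))).mp hd)

end General

/-! ## §2 With THEOREM AL: outside the unique sign-`−1` prime every simple prime is NON-SPLIT -/

section SignLaw

variable {N : ℕ} [NeZero N]

/-- At `p ∥ N` the Atkin–Lehner sign is `−a_p(f)`. [cite: AtkinLehner1970, Thm. 3] -/
theorem atkinLehnerEigenvalueAt_eq_neg_cuspCoeff {f : CuspForm (Gamma0 N) 2} (hf : IsNewform0 f) {p : ℕ} (hp : p.Prime)
    (hpN : p ∣ N) (hp2 : ¬ p ^ 2 ∣ N) : atkinLehnerEigenvalueAt f p = -cuspCoeff f p := by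
  haveI : Fact p.Prime := ⟨hp⟩
  obtain ⟨M, hM⟩ := hpN
  have hpM : ¬ p ∣ M := fun ⟨M', h⟩ ↦ hp2 ⟨M', by rw [hM, h]; ring⟩
  exact hf.atkinLehnerEigenvalueAt_eq_neg_coeff_of_not_dvd p hM hpM

/-- **Only one split prime.**  For an odd prime `ℓ ∣ [Λ₀(f):Λ₁(f)]`: if some `q ∥ N` has `a_q(f) = +1` (sign `−1` at `q`), then every other
`p ∥ N` has `a_p(f) = −1` and `ℓ ∣ p + 1` (THEOREM AL, tree `atkinLehnerShimuraSignLaw_holds`: exactly one sign `−1`; plus §1).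
[cite: ByeonKim2014, Prop. 4.1] [cite: LingOesterle1991, Thm. 3 and Thm. 6] -/
theorem cuspCoeff_eq_neg_one_of_ne_of_not_shimuraIndexPrimeTo {f : CuspForm (Gamma0 N) 2} (hf : IsNewform0 f) {ℓ : ℕ}
    (hℓ : ℓ.Prime) (hℓ2 : ℓ ≠ 2) (hS : ¬ ShimuraIndexPrimeTo ℓ f) {q : ℕ} (hq : q.Prime) (hqN : q ∣ N) (hq2 : ¬ q ^ 2 ∣ N)
    (haq : cuspCoeff f q = 1) {p : ℕ} (hp : p.Prime) (hpN : p ∣ N) (hp2 : ¬ p ^ 2 ∣ N) (hpq : p ≠ q) :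
    cuspCoeff f p = -1 ∧ (ℓ : ℤ) ∣ (p : ℤ) + 1 := by
  obtain ⟨q₀, -, huniq⟩ := atkinLehnerShimuraSignLaw_holds N f hf ℓ hℓ hℓ2 hS
  have hεq : atkinLehnerEigenvalueAt f q = -1 := by rw [atkinLehnerEigenvalueAt_eq_neg_cuspCoeff hf hq hqN hq2, haq]
  have hq₀ : q = q₀ := huniq q ⟨hq, hqN, hεq⟩
  rcases cuspCoeff_eq_of_not_sq_dvd_of_not_shimuraIndexPrimeTo hf hℓ hS hp hpN hp2 with ⟨hap, -⟩ | h
  · have hεp : atkinLehnerEigenvalueAt f p = -1 := by rw [atkinLehnerEigenvalueAt_eq_neg_cuspCoeff hf hp hpN hp2, hap]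
    exact absurd ((huniq p ⟨hp, hpN, hεp⟩).trans hq₀.symm) hpq
  · exact h

end SignLaw

/-! ## §3 `ℓ = 5`: the admissible primes of the level -/

section Five

variable {N : ℕ} [NeZero N]

/-- **Level profile at `ℓ = 5` (newform only).**  If `5 ∣ [Λ₀(f):Λ₁(f)]` then every prime `p ∣ N` is: `5` with `25 ∣ N`; or simple and SPLIT
with `p ≡ 1 (mod 5)`; or simple and NON-SPLIT with `p ≡ 4 (mod 5)`. [cite: LingOesterle1991, Thm. 6] [cite: AtkinLehner1970, Thm. 3] -/
theorem level_profile_five {f : CuspForm (Gamma0 N) 2} (hf : IsNewform0 f) (hS : ¬ ShimuraIndexPrimeTo 5 f) {p : ℕ} (hp : p.Prime)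
    (hpN : p ∣ N) :
    (p = 5 ∧ 5 ^ 2 ∣ N) ∨ (¬ p ^ 2 ∣ N ∧ cuspCoeff f p = 1 ∧ p % 5 = 1) ∨ (¬ p ^ 2 ∣ N ∧ cuspCoeff f p = -1 ∧ p % 5 = 4) := by
  have h5 : Nat.Prime 5 := by norm_num
  by_cases h2 : p ^ 2 ∣ N
  · obtain rfl := eq_of_sq_dvd_of_not_shimuraIndexPrimeTo hf h5 hS hp h2
    exact Or.inl ⟨rfl, h2⟩
  · rcases cuspCoeff_eq_of_not_sq_dvd_of_not_shimuraIndexPrimeTo hf h5 hS hp hpN h2 with ⟨ha, hd⟩ | ⟨ha, hd⟩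
    · refine Or.inr (Or.inl ⟨h2, ha, ?_⟩)
      omega
    · refine Or.inr (Or.inr ⟨h2, ha, ?_⟩)
      omega

/-- **No prime `≡ ±2 (mod 5)` divides the level** (`2, 3, 7, 13, 17, 23, …`). -/
theorem not_dvd_level_of_mod_five {f : CuspForm (Gamma0 N) 2} (hf : IsNewform0 f) (hS : ¬ ShimuraIndexPrimeTo 5 f) {p : ℕ}
    (hp : p.Prime) (hmod : p % 5 = 2 ∨ p % 5 = 3) : ¬ p ∣ N := by
  intro hpN
  rcases level_profile_five hf hS hp hpN with ⟨rfl, -⟩ | ⟨-, -, h⟩ | ⟨-, -, h⟩ <;> omega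

/-- In particular the level is odd, prime to `3` and prime to `7`. -/
theorem not_two_three_seven_dvd_level {f : CuspForm (Gamma0 N) 2} (hf : IsNewform0 f) (hS : ¬ ShimuraIndexPrimeTo 5 f) :
    ¬ 2 ∣ N ∧ ¬ 3 ∣ N ∧ ¬ 7 ∣ N :=
  ⟨not_dvd_level_of_mod_five hf hS Nat.prime_two (by norm_num), not_dvd_level_of_mod_five hf hS Nat.prime_three (by norm_num),
    not_dvd_level_of_mod_five hf hS (by norm_num) (by norm_num)⟩

/-- `5 ∣ N ⟹ 25 ∣ N`. -/
theorem twentyfive_dvd_of_five_dvd {f : CuspForm (Gamma0 N) 2} (hf : IsNewform0 f) (hS : ¬ ShimuraIndexPrimeTo 5 f) (h5 : 5 ∣ N) :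
    25 ∣ N := by
  simpa using sq_dvd_of_dvd_of_not_shimuraIndexPrimeTo hf (by norm_num) hS h5

/-- **`(N, 42) = 1` and `5 ∣ N ⟹ 25 ∣ N`** — the level constraints of a `5` in the Shimura index of ANY newform (row E-es-230). -/
theorem level_coprime_fortytwo {f : CuspForm (Gamma0 N) 2} (hf : IsNewform0 f) (hS : ¬ ShimuraIndexPrimeTo 5 f) :
    ¬ 2 ∣ N ∧ ¬ 3 ∣ N ∧ ¬ 7 ∣ N ∧ (5 ∣ N → 25 ∣ N) :=
  ⟨(not_two_three_seven_dvd_level hf hS).1, (not_two_three_seven_dvd_level hf hS).2.1, (not_two_three_seven_dvd_level hf hS).2.2,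
    twentyfive_dvd_of_five_dvd hf hS⟩

/-- At squarefree level: `5 ∤ N` and every `p ∣ N` is simple with `p ≡ a_p(f) = ±1 (mod 5)`. -/
theorem level_profile_five_of_squarefree {f : CuspForm (Gamma0 N) 2} (hf : IsNewform0 f) (hS : ¬ ShimuraIndexPrimeTo 5 f)
    (hsq : Squarefree N) {p : ℕ} (hp : p.Prime) (hpN : p ∣ N) :
    ¬ 5 ∣ N ∧ ((cuspCoeff f p = 1 ∧ p % 5 = 1) ∨ (cuspCoeff f p = -1 ∧ p % 5 = 4)) := by
  have hnsq : ∀ q : ℕ, q.Prime → ¬ q ^ 2 ∣ N := fun q hq h ↦ by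
    have := hsq q (by simpa [sq] using h)
    exact hq.not_isUnit this
  refine ⟨fun h5 ↦ hnsq 5 (by norm_num) (by simpa using twentyfive_dvd_of_five_dvd hf hS h5), ?_⟩
  rcases level_profile_five hf hS hp hpN with ⟨-, h⟩ | ⟨-, h⟩ | ⟨-, h⟩
  · exact absurd h (hnsq 5 (by norm_num))
  · exact Or.inl h
  · exact Or.inr h

end Five

/-! ## §4 `ℓ = 5` on a lattice-optimal datum: ROAD β puts `11` into the level, the sieve makes it simple and split, THEOREM AL makes
every other simple prime non-split -/

section Datum

variable (W₀ : WeierstrassCurve ℚ) [W₀.IsElliptic] [W₀.IsGloballyMinimal] {N : ℕ} [NeZero N]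

/-- **The `11` of a `5` in the Shimura index is simple and split**: for a lattice-optimal `X₀(N)`-datum with `5 ∣ [Λ₀(f):Λ₁(f)]`:
`11 ∣ N` (ROAD β), `11² ∤ N`, `a₁₁(f) = +1`, Atkin–Lehner sign `−1` at `11`.
[cite: LingOesterle1991, Thm. 6] [cite: AtkinLehner1970, Thm. 3] [cite: Vatsal2005, Rem. 1.8] -/
theorem eleven_profile (D₀ : ModularParametrizationData W₀ N)
    (hopt : ∀ z ∈ D₀.L.lattice, ∃ w ∈ periodLattice D₀.f, z = D₀.c * w) (hS : ¬ ShimuraIndexPrimeTo 5 D₀.f) :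
    11 ∣ N ∧ ¬ 11 ^ 2 ∣ N ∧ cuspCoeff D₀.f 11 = 1 ∧ atkinLehnerEigenvalueAt D₀.f 11 = -1 := by
  have hf : IsNewform0 D₀.f := D₀.isNewformOf.1
  have h11p : Nat.Prime 11 := by norm_num
  have h11 : 11 ∣ N := ShimuraFive.eleven_dvd_level_of_not_shimuraIndexPrimeTo_five W₀ D₀ hopt hS
  have h2 : ¬ 11 ^ 2 ∣ N := not_sq_dvd_of_ne_of_not_shimuraIndexPrimeTo hf (by norm_num) hS h11p (by norm_num)
  have ha : cuspCoeff D₀.f 11 = 1 := by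
    rcases cuspCoeff_eq_of_not_sq_dvd_of_not_shimuraIndexPrimeTo hf (by norm_num) hS h11p h11 h2 with ⟨h, -⟩ | ⟨-, h⟩
    · exact h
    · exfalso; omega
  exact ⟨h11, h2, ha, by rw [atkinLehnerEigenvalueAt_eq_neg_cuspCoeff hf h11p h11 h2, ha]⟩

/-- **THE LEVEL PROFILE of a `5` in the Shimura index** (lattice-optimal `X₀(N)`-datum of a minimal `W₀`): every prime `p ∣ N` is `5` (then
`25 ∣ N`), or `11` (simple, split: `a₁₁ = +1`), or a simple NON-SPLIT prime `p ≡ −1 (mod 5)` (`a_p = −1`).  So `N = 5^e · 11 · ∏ pᵢ` with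
`e ≠ 1` and distinct `pᵢ ≡ 4 (mod 5)`.  The cell row E-es-224 («then `N = 11`») is thereby OPEN exactly on `{25 ∣ N}` and on the squarefree
levels `11·∏pᵢ` — Byeon–Kim's printed range. [cite: ByeonKim2014, Thm. 1.1 and Prop. 4.1] [cite: LingOesterle1991, Thm. 6] [cite: AtkinLehner1970, Thm. 3] -/
theorem level_profile_five_datum (D₀ : ModularParametrizationData W₀ N)
    (hopt : ∀ z ∈ D₀.L.lattice, ∃ w ∈ periodLattice D₀.f, z = D₀.c * w) (hS : ¬ ShimuraIndexPrimeTo 5 D₀.f) {p : ℕ} (hp : p.Prime)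
    (hpN : p ∣ N) :
    (p = 5 ∧ 25 ∣ N) ∨ (p = 11 ∧ ¬ 11 ^ 2 ∣ N ∧ cuspCoeff D₀.f 11 = 1) ∨
      (p % 5 = 4 ∧ ¬ p ^ 2 ∣ N ∧ cuspCoeff D₀.f p = -1) := by
  have hf : IsNewform0 D₀.f := D₀.isNewformOf.1
  obtain ⟨h11, h112, ha11, -⟩ := eleven_profile W₀ D₀ hopt hS
  rcases level_profile_five hf hS hp hpN with ⟨rfl, h25⟩ | ⟨hp2, hap, -⟩ | ⟨hp2, hap, hmod⟩
  · exact Or.inl ⟨rfl, by simpa using h25⟩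
  · -- a split prime is the unique sign-`−1` prime, which is `11`
    by_cases hp11 : p = 11
    · subst hp11; exact Or.inr (Or.inl ⟨rfl, h112, ha11⟩)
    · have h := cuspCoeff_eq_neg_one_of_ne_of_not_shimuraIndexPrimeTo hf (by norm_num) (by norm_num) hS (by norm_num) h11 h112
        ha11 hp hpN hp2 hp11
      rw [hap] at h
      norm_num at h
  · exact Or.inr (Or.inr ⟨hmod, hp2, hap⟩)

/-- Squarefree level, hopt-free (ROAD β transported, tree `ShimuraFive.eleven_dvd_level_of_not_shimuraIndexPrimeTo_five_of_squarefree`):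
`N = 11 · ∏ pᵢ` with `a₁₁ = +1` and every other `pᵢ ≡ −1 (mod 5)` non-split; in particular `5 ∤ N`. [cite: ByeonKim2014, Thm. 1.1 and Prop. 4.1] -/
theorem level_profile_five_of_squarefree' (W : WeierstrassCurve ℚ) [W.IsElliptic] [W.IsGloballyMinimal] (D : ModularParametrizationData W N)
    (hsq : Squarefree N) (hS : ¬ ShimuraIndexPrimeTo 5 D.f) {p : ℕ} (hp : p.Prime) (hpN : p ∣ N) :
    ¬ 5 ∣ N ∧ 11 ∣ N ∧ cuspCoeff D.f 11 = 1 ∧ (p = 11 ∨ (p % 5 = 4 ∧ cuspCoeff D.f p = -1)) := by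
  have hf : IsNewform0 D.f := D.isNewformOf.1
  have hnsq : ∀ q : ℕ, q.Prime → ¬ q ^ 2 ∣ N := fun q hq h ↦ by
    have := hsq q (by simpa [sq] using h)
    exact hq.not_isUnit this
  have h11 : 11 ∣ N := ShimuraFive.eleven_dvd_level_of_not_shimuraIndexPrimeTo_five_of_squarefree W hsq D hS
  obtain ⟨h5, hprof11⟩ := level_profile_five_of_squarefree hf hS hsq (by norm_num) h11
  have ha11 : cuspCoeff D.f 11 = 1 := by
    rcases hprof11 with ⟨h, -⟩ | ⟨-, h⟩
    · exact h
    · exfalso; omega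
  refine ⟨h5, h11, ha11, ?_⟩
  by_cases hp11 : p = 11
  · exact Or.inl hp11
  · obtain ⟨ha, hd⟩ := cuspCoeff_eq_neg_one_of_ne_of_not_shimuraIndexPrimeTo hf (by norm_num) (by norm_num) hS (by norm_num)
      h11 (hnsq 11 (by norm_num)) ha11 hp hpN (hnsq p hp) hp11
    exact Or.inr ⟨by omega, ha⟩

end Datum

end Summit.BirchSwinnertonDyer.BirchSwinnertonDyer.Theorems.ManinLocalTwoThree.ShimuraSieve

end
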